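/- Copyright: the b2b-balaban cell (near-miss cell 7), T⁴-continuum fan-out; row NE7b CRUX team (2), seat
t4-ne7b-formalise-leaf-01 (gen 72) — typist's build of the OWNER's INTERFACE REQUEST NE7b IR-101-3 «THE NON-TOWER ROUNDED END»
(OWNER t4-ne7b-p1 g101, journal l.49019 ∕ INBOX [NE7bP1-G101-INBOX-CLOSE]), item (b) of 2: the road — the rounded lattice-unit
record `HistReadDataLWR` embedded into the plug record at M5-2e's weight under leaf-06's LATTICE window, with the rounding room
supplied at PRINT's letter `(t, Ap₁) = (d+5, 1)` by the OWNER's generic M5 junction, the L-witness, and the terminal theorem over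
the new record.  Released under the licence of the surrounding project. -/
import Summits.QuantumFields.BalabanUV.T4Continuum.Support.HistoryRealiseCellsRunAssemblyWTVSLWP82
import Summits.QuantumFields.BalabanUV.T4Continuum.Support.HistoryRealiseCellsRunAssemblyWTVSDataLWR

/-!
# THE NON-TOWER ROUNDED ROAD: `HistReadDataLWR.toLP82LR`, THE L-WITNESS, AND THE TERMINAL THEOREM
# `continuumYM4Torus_of_histReadingLWR_fsc` (INTERFACE REQUEST NE7b IR-101-3 (b); re-open object (α) of row NE7b; typist lineage
# `t4-ne7b-formalise-leaf-01` gen 72)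

Summits-side support leaf of the T⁴-continuum cell (rung (B)+1 on a FINITE torus only; NOT infinite volume, NOT the mass gap, NOT
the Clay statement; NOT a proof of the spine estimate NE7b — the cell's OWN estimate `T4WeightBudget.RelWeightBound`, NOT PRINTED,
NOT PROVED).  [folklore] composition BY NAME: one theorem (the plug, LWLP82's `plug82L_of_histReadingLWL` over the rounded record,
field for field), one `def` (the embedding `HistReadDataLWR.toLP82LR` into the plug record `HistReadDataLP`, p300797's type), its
`_data` lemma and two theorems (the L-witness = W4 §1 ∘ `toLP82LR`; the terminal theorem = W4's `continuumYM4Torus_of_histReadingLP_fsc`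
∘ the two-window junction ∘ `toLP82LR` inside `ForSmallCouplings`); no `[cite:]` tag, nothing printed asserted, no `Prop` fact minted,
zero `sorry`; v1.1 = v1 minus LWLP82's now-idle `open … HistoryBankingRoundingUnrounded (sRunr ApFlat)` (chair leaf-05 g121's cosmetic note
D-X1013-1, journal l.49250).  Append-only elsewhere: every landed statement (`…LWL_fsc` p303949, `…LP_fsc`, the tower's `…towerReadingLWR_fsc`
p347728, …) UNCHANGED BY NAME AND TYPE; the terminal statement here is NEW because its record TYPE is new (`HistReadDataLWR`, one
letter FEWER — no `Lr` — in the prefix-outside parameter block) — not a re-declaration.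

WHY (OWNER RULING R-ne7bp1-g101-5, l.48674; LOCATED OWNER FINDING F-ne7bp1-g101-2; INTERFACE REQUEST NE7b IR-101-3, l.49019; part
(a)'s docstring has the located reason in full).  LWLP82's road `HistReadDataLWL.toLP82L` fills the plug record's renewal letters
`sR`∕`sR′` with the UNROUNDED `sRunr …` (`S_h`, CASE 2 of p. 383 only) and its rounding rooms `hRR`∕`hRR′` with
`roundingRoomF_unrounded_of_inInterval` at `(t, Ap₁) := (d+3, ApFlat …)` — OVER-SHARP for print's CASE-1 preparatory factor (p. 382,
`exp(−A₁²48⁻²R_j⁻⁸p₁²(g_j))`).  THIS road is the same text with `(t, Ap₁) := (d+5, 1)`: `sR := fun K => sRsharp (O.d + 5) 1 p₁ (ℛ.R K)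
g^K` (print's `r_h = R_h^{−(d+5)}·p₁(g_h)²`, [B16] p. 383 «the largest factor among all the small factors … in the preparatory steps …
we assume that 2p₁ − (d+5)r₀ > p₀», LOCATOR), `hRR := roundingRoomF_mono (hsB K) (fun _ => le_rfl) (roundingRoomF_sharp_of_couplings
(t := O.d + 5) (Ap₁ := 1) …)` at the threshold `ellStar C O F.L (O.d + 5) η η′ κ 1 Φ` (the M5 supply lemma at generic `(t, Ap₁)`, by
name — EXACTLY the OWNER's 2R junction `TowerReadDataLWR.toLP82R`, p347728, with the record's own slots in place of the tower's
J-chain), the volume side (`hplug`, `huV`, `wV`, `hwV`) exactly as LWLP82.  The terminal theorem binds TEN window letters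
`cΛ M Φ b₀ p₁ η η′ κ κ₂ κᵥ` (no `Lr`).

WHAT.  §1 **`plug82LR_of_histReadingLWR`** (LWLP82 §1's plug over `HistReadDataLWR`, token for token: the lattice prefix
`InInterval e^{−ℓᵥ82ᴸ∕2} K` + the record's `hΛL K` ⊢ leaf-06's eight binders ⊢ W5 §0 `plug_of_shrunk82` at the weight
`cvol82 d (jvol82 d ((1+β₀)·L^d)) ((1+β₀)·L^d)`, `L := F.L`); **`HistReadDataLWR.toLP82LR (Dd) (hIr) (hIvL) : HistReadDataLP …`** GIVEN
the rounding window `InInterval e^{−ℓ⋆∕2} K` at `ℓ⋆ := ellStar C O F.L (O.d + 5) η η′ κ 1 Φ` and the LATTICE volume window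
`InInterval e^{−ℓᵥ82ᴸ∕2} K` for every cutoff — `sR`∕`sR′` at print's rounded letter, `hRR`∕`hRR′` by 2R's junction at the record's birth
letters `sB K` ∕ `sB′ K` (floors `hsB` ∕ `hsB′`), everything else copied from `toLP82L`; `toLP82LR_data` (8 `rfl`).  §2
**`nonempty_countRoadWitnessT3bWTVSL_of_histReadingLWR82`** (W4 §1 ∘ `toLP82LR`).  §3 **`continuumYM4Torus_of_histReadingLWR_fsc`**:
the headline predicate from SOME rounded lattice-unit prefix record for all small couplings — W4's `continuumYM4Torus_of_histReadingLP_fsc`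
∘ `forSmallCouplings_mono_inInterval₂` at the closed thresholds `e^{−ℓ⋆∕2}` (rounding at print's `t = d+5`) and `e^{−ℓᵥ82ᴸ∕2}`
(LATTICE volume) ∘ §1.

BY-NAME EFFECT (for the OWNER's WALL ∕ LEDGERS memo, not asserted here): the non-tower (α) END now has a road at print's ROUNDED
renewal letter, so F-ne7bp1-g101-2 is repaired for the non-tower form as it was for the tower form by 1R–3R; classes unchanged
(`hF`∕`upB` R-class displays at a moved letter; `hΛL` R = H3 ∕ M2-B; exponent rows ∕ signs C-side; (WS1⁸²ᴸ)–(WS4⁸²ᴸ) = smallness of OUR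
letters inside `ForSmallCouplings`); LWL ∕ LWLP82 stay in the tree as the record of the `S_h` choice (the OWNER words the record
status).  HONEST SCOPE.  CONDITIONAL on everything the record displays; ρ UNVALUED; nothing of Bałaban's asserted, instantiated or
discharged; NEEDS-CONSTANT 0; NE7b NOT proved; spine 0∕9.  HONEST DEPENDENCY (cell): continuum YM on T⁴ ⇐ BetaPertH ∧ nine spine
estimates (0/9 proved); BetaPertH ⇐ (D1) ∧ (D4) ∧ CAP+tail; G-an2-4 gates asym, D1 and NE2/3/4.  This file changes none of it.
-/
open Finset MeasureTheory
open Literature.MathematicalPhysics.QuantumFieldTheory.Balaban1983to89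
open T4PersistenceDictionary T4PersistentHistoryCount T4BankedInduction T4PrintedShapeBanking
open T4WeightBudget T4GlobalDenominator T4LiveClassFibration T4LiveStructureGas T4LiveGasToTerms T4RecordPriceSeam
open T4PartnerMultiplicity T4IndicatorShell T4MatchingAssembly T4MatchingClosure T4MatchingClosureSocket T4Continuum
open T4StabilitySocket T4BranchingRecordsGas T4TaggedShapeBanking T4CanonicalMenus T4RenewalChains
open Summit.QuantumFields.BalabanUV.T4Continuum.PlacementBatch Summit.QuantumFields.BalabanUV.T4Continuum.PlacementSkeleton
open Summit.QuantumFields.BalabanUV.T4Continuum.CountThresholdUniform Summit.QuantumFields.BalabanUV.T4Continuum.CountThresholdExit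
open Summit.QuantumFields.BalabanUV.T4Continuum.CountSeamJunction Summit.QuantumFields.BalabanUV.T4Continuum.LateMergers
open Summit.QuantumFields.BalabanUV.T4Continuum.HistoryFlow Summit.QuantumFields.BalabanUV.T4Continuum.HistoryRegeneration
open Summit.QuantumFields.BalabanUV.T4Continuum.HistoryTables Summit.QuantumFields.BalabanUV.T4Continuum.HistoryAssemblyTrees
open Summit.QuantumFields.BalabanUV.T4Continuum.HistoryAssemblyTerms Summit.QuantumFields.BalabanUV.T4Continuum.HistoryAssemblyPedigree
open Summit.QuantumFields.BalabanUV.T4Continuum.HistoryConstants Summit.QuantumFields.BalabanUV.T4Continuum.HistoryGen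
open Literature.MathematicalPhysics.QuantumFieldTheory.Balaban1983to89.B13ScaleTransfer
open Summit.QuantumFields.BalabanUV.T4Continuum.ZoneSkeleton Summit.QuantumFields.BalabanUV.T4Continuum.HistorySocketTH
open Summit.QuantumFields.BalabanUV.T4Continuum.HistoryCaps Summit.QuantumFields.BalabanUV.T4Continuum.HistoryAssemblyPrice
open Summit.QuantumFields.BalabanUV.T4Continuum.HistoryBankingLE Summit.QuantumFields.BalabanUV.T4Continuum.HistoryExitLE
open Summit.QuantumFields.BalabanUV.T4Continuum.HistoryAssemblyTreesLE Summit.QuantumFields.BalabanUV.T4Continuum.HistoryAssemblyTermsLE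
open Summit.QuantumFields.BalabanUV.T4Continuum.HistoryRealise Summit.QuantumFields.BalabanUV.T4Continuum.HistoryAssemblyRealiseLE
open Summit.QuantumFields.BalabanUV.T4Continuum.HistoryAssemblyMult Summit.QuantumFields.BalabanUV.T4Continuum.HistoryAssemblyMultKey
open Summit.QuantumFields.BalabanUV.T4Continuum.HistoryAssemblyRealiseRun Summit.QuantumFields.BalabanUV.T4Continuum.HistoryAssemblyRealiseMult
open Summit.QuantumFields.BalabanUV.T4Continuum.HistoryZones Summit.QuantumFields.BalabanUV.T4Continuum.HistoryRealiseCells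
open Summit.QuantumFields.BalabanUV.T4Continuum.HistoryRealiseCellsRun Summit.QuantumFields.BalabanUV.T4Continuum.HistoryAssemblyRealiseRunMult
open Summit.QuantumFields.BalabanUV.T4Continuum.HistoryRealiseCellsRunMult Summit.QuantumFields.BalabanUV.T4Continuum.HistoryAssemblyMultInstance
open Summit.QuantumFields.BalabanUV.T4Continuum.HistoryJoinsPlacedMember Summit.QuantumFields.BalabanUV.T4Continuum.PlacementSkeleton
open Summit.QuantumFields.BalabanUV.T4Continuum.HistoryJoinsPlacedMult Summit.QuantumFields.BalabanUV.T4Continuum.HistoryRealiseDistinct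
open Summit.QuantumFields.BalabanUV.T4Continuum.HistoryRegionTemplates Summit.QuantumFields.BalabanUV.T4Continuum.HistoryCaps
open Summit.QuantumFields.BalabanUV.T4Continuum.HistoryZoneEvolve (cth)
open Literature.MathematicalPhysics.QuantumFieldTheory.Balaban1983to89.B16SProfile (DropCtl)
open Summit.QuantumFields.BalabanUV.T4Continuum.HistoryRealiseCellsRunMultEnd Summit.QuantumFields.BalabanUV.T4Continuum.HistoryRealiseCellsRunMultEndD
open Summit.QuantumFields.BalabanUV.T4Continuum.HistoryRealiseCellsRunPinnedT3b Summit.QuantumFields.BalabanUV.T4Continuum.HistoryHybridRescale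
open Summit.QuantumFields.BalabanUV.T4Continuum.HistoryRealiseCellsRunApex (exists_const_schemeZ)
open Summit.QuantumFields.BalabanUV.T4Continuum.HistoryRealisePrint Summit.QuantumFields.BalabanUV.T4Continuum.HistoryRealiseWeak
open Summit.QuantumFields.BalabanUV.T4Continuum.HistoryRealisePrintReading Summit.QuantumFields.BalabanUV.T4Continuum.HistoryRealiseWeakReading
open Summit.QuantumFields.BalabanUV.T4Continuum.HistoryRealisePrintCells Summit.QuantumFields.BalabanUV.T4Continuum.HistoryRealiseWeakCells
open Summit.QuantumFields.BalabanUV.T4Continuum.HistoryRealiseCellsRunApexT3b Summit.QuantumFields.BalabanUV.T4Continuum.HistoryRealiseCellsRunApexT3bW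

open Summit.QuantumFields.BalabanUV.T4Continuum.HistoryRealiseCellsRunApexT3bWT Summit.QuantumFields.BalabanUV.T4Continuum.HistoryRealiseCellsRunPinnedT3bWT
open Summit.QuantumFields.BalabanUV.T4Continuum.HistoryRealiseCellsRunHeadlineT3bWT
open Summit.QuantumFields.BalabanUV.T4Continuum.HistoryRealiseCellsRunApexT3bWTV Summit.QuantumFields.BalabanUV.T4Continuum.HistoryBankingVolumePlug
open Summit.QuantumFields.BalabanUV.T4Continuum.HistoryRealiseCellsRunApexT3bWTVS
open Summit.QuantumFields.BalabanUV.T4Continuum.HistoryGenealogyRealise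
open Summit.QuantumFields.BalabanUV.T4Continuum.HistoryGenealogyInstantiate
open Summit.QuantumFields.BalabanUV.T4Continuum.B16HistoryIndexedRepr
open Summit.QuantumFields.BalabanUV.T4Continuum.B16HistoryIndexedTrunc
open Summit.QuantumFields.BalabanUV.T4Continuum.HistoryBankingDiscountCharge
open Summit.QuantumFields.BalabanUV.T4Continuum.HistoryBankingCreditRead
open Summit.QuantumFields.BalabanUV.T4Continuum.HistoryBankingFibreRoom
open Summit.QuantumFields.BalabanUV.T4Continuum.HistoryPriceKeys
open Summit.QuantumFields.BalabanUV.T4Continuum.HistoryRealiseCellsRunSupplyWTVS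
open Summit.QuantumFields.BalabanUV.T4Continuum.HistoryRealiseCellsRunSupplyKeysWTVS

open Summit.QuantumFields.BalabanUV.T4Continuum.HistoryRealiseCellsRunAssemblyWTVSData
open Summit.QuantumFields.BalabanUV.T4Continuum.HistoryRealiseCellsRunAssemblyWTVSDataL
open Summit.QuantumFields.BalabanUV.T4Continuum.HistoryRealiseCellsRunAssemblyWTVSDataLW
open Summit.QuantumFields.BalabanUV.T4Continuum.HistoryRealiseCellsRunAssemblyWTVSL
open Summit.QuantumFields.BalabanUV.T4Continuum.HistoryRealiseCellsRunApexT3bWTVSL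
open Summit.QuantumFields.BalabanUV.T4Continuum.HistoryBankingSharpShares (sBsharp sRsharp)
open Summit.QuantumFields.BalabanUV.T4Continuum.HistoryBankingRoundingSupply (ellStar roundingRoomF_mono roundingRoomF_sharp_of_couplings)
open Summit.QuantumFields.BalabanUV.T4Continuum.HistoryBankingRoundingTuned
open Summit.QuantumFields.BalabanUV.T4Continuum.HistoryBankingVolumeWindow
open Summit.QuantumFields.BalabanUV.T4Continuum.HistoryBankingVolumeSupply

open Summit.QuantumFields.BalabanUV.T4Continuum.HistoryBankingForestVolume
open Summit.QuantumFields.BalabanUV.T4Continuum.HistoryBankingForestPlug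
open Summit.QuantumFields.BalabanUV.T4Continuum.HistoryBankingAnchors82
open Summit.QuantumFields.BalabanUV.T4Continuum.HistoryBankingShrunkLedger82
open Summit.QuantumFields.BalabanUV.T4Continuum.HistoryBankingShrunkWitness82
open Summit.QuantumFields.BalabanUV.T4Continuum.HistoryBankingVolumeWindowCollar
open Summit.QuantumFields.BalabanUV.T4Continuum.HistoryBankingVolumeWindowShrunk82
open Summit.QuantumFields.BalabanUV.T4Continuum.B16HistoryWeightPlugW
open Summit.QuantumFields.BalabanUV.T4Continuum.HistoryRealiseCellsRunSupplyWTVSW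
open Summit.QuantumFields.BalabanUV.T4Continuum.HistoryRealiseCellsRunAssemblyWTVSDataLW
open Summit.QuantumFields.BalabanUV.T4Continuum.HistoryRealiseCellsRunAssemblyWTVSDataLP
open Summit.QuantumFields.BalabanUV.T4Continuum.HistoryRealiseCellsRunAssemblyWTVSLW
open Summit.QuantumFields.BalabanUV.T4Continuum.HistoryRealiseCellsRunAssemblyWTVSLP
open Summit.QuantumFields.BalabanUV.T4Continuum.HistoryBankingVolumeWindowLattice
open Summit.QuantumFields.BalabanUV.T4Continuum.HistoryRealiseCellsRunAssemblyWTVSLWP82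
open Summit.QuantumFields.BalabanUV.T4Continuum.HistoryRealiseCellsRunAssemblyWTVSDataLWR

namespace Summit.QuantumFields.BalabanUV.T4Continuum.HistoryRealiseCellsRunAssemblyWTVSLWRP82R

noncomputable section

set_option synthInstance.maxSize 1024

/-! ## §1 The embedding at M5-2e's weight read at the lattice growth, under the lattice window, AT PRINT's ROUNDED RENEWAL LETTER -/

section Embed

variable {F : T4Family} {G : Type*} [GaugeGroup G] [MeasurableSpace G] [HaarData G] [RegularGaugeGroup G]
  {D : FiniteEpsData F G} {C : T4PrintedShapeBanking.Consts} {O : PrintedO1s} {θv : ℝ} {rr d n : ℕ} {hn : 0 < n}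
  {g₀ : ℕ → ℝ} {os : List (ULoop F)} {cΛ M Φ β₀ : ℝ} {p₁ η η' κ κ₂ κᵥ : ℕ} {DomK : ℕ → Type}
  {I : (K : ℕ) → HIndex (DomK K)} [DecidableEq (HIndex.Idx I)] {DomK' : ℕ → Type} {I' : (K : ℕ) → HIndex (DomK' K)}
  {Xs : ℕ → Type} [∀ K, MeasurableSpace (Xs K)] {μ : (K : ℕ) → Measure (Xs K)} [∀ K, IsFiniteMeasure (μ K)]
  {𝒢 : (K : ℕ) → GoodClass (Xs K)} {Y : ℕ → Type} [∀ K, MeasurableSpace (Y K)] {νB : (K : ℕ) → Measure (Y K)}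
  [∀ K, IsFiniteMeasure (νB K)] {𝒢' : (K : ℕ) → GoodClass (Y K)}

omit [RegularGaugeGroup G] in
/-- **THE PLUG OF A ROUNDED LATTICE-UNIT PREFIX RECORD AT M5-2e's LEDGER, per term** — LWLP82's `plug82L_of_histReadingLWL` over
`HistReadDataLWR`, token for token (the renewal letter is not read by the volume side): under the LATTICE volume window
`InInterval e^{−ℓᵥ82ᴸ∕2} K`, leaf-06's `volumeDisplaysS82L_of_log_eq_of_inInterval` at the record's `hΛL K` — fed by `hexpFL hdq hexpVL`,
the signs, `1 ≤ F.L` (derived), (2.7) `h27`, (2.9) `h29` and (2.5) `isRj` at `L := F.L` — supplies (E4)'s eight binders on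
`u = log ∘ Λ K`, and W5 §0 `plug_of_shrunk82` turns them into the plug at `w = cvol82 d (jvol82 d ((1+β₀)·L^d)) ((1+β₀)·L^d)` on the run
read off each term. [folklore] -/
theorem plug82LR_of_histReadingLWR
    (Dd : HistReadDataLWR D C O θv rr d n hn g₀ os cΛ M Φ β₀ p₁ η η' κ κ₂ κᵥ I I' Xs μ 𝒢 Y νB 𝒢')
    (hIvL : ∀ K, (D.C ⟨K, F.m, g₀ K⟩).flow.InInterval
      (Real.exp (-(ellVolS82L C d κ₂ κᵥ cΛ M F.L θv ((1 + β₀) * F.L ^ d) (jvol82 d ((1 + β₀) * F.L ^ d)) / 2))) K) :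
    ∀ K, Dd.K₀ ≤ K → ∀ τ ∈ HIndex.termSet I K, ∀ x ∈ (Dd.ℛ.inputOf.run K τ).histV.comp K,
      Real.exp (treeVol Dd.ℛ.L (Dd.ℛ.s K) (fun v => (v : ℝ)) (Dd.ℛ.inputOf.run K τ).pedMV
          (fun j => Real.log (Dd.Φf.Λ K j)) K (K, x)) ≤
        Real.exp (lifeCost (dictWT Prod.fst (Dd.ℛ.R K) C.n₁) (costT Prod.fst C K (Dd.ℛ.R K))
            ((Dd.ℛ.inputOf.run K τ).pedMV.genT (K, x))) *
          Real.exp (birthWT Prod.fst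
            (fun m => cvol82 d (jvol82 d ((1 + β₀) * F.L ^ d)) ((1 + β₀) * F.L ^ d) * Real.log (Dd.Φf.Λ K m))
            ((Dd.ℛ.inputOf.run K τ).pedMV.genT (K, x))) := by
  intro K hK τ hτ
  obtain ⟨⟨a, h, l, c⟩, -, hpe⟩ := Finset.mem_map.mp hτ
  have hτe : τ = ⟨K, a, (h, l, c)⟩ := hpe.symm
  subst hτe
  have hL0 : 0 < Dd.ℛ.L := by rw [Dd.hL]; exact lt_of_lt_of_le (by norm_num) (two_le_L F)
  have hL4 : 4 ≤ Dd.ℛ.L := by rw [Dd.hL]; exact Dd.hL4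
  have hL1 : 1 ≤ F.L := le_trans (by norm_num) (two_le_L F)
  have hdrop : ∀ m, DropCtl (Dd.ℛ.s K) m := by rw [Dd.hs]; exact Dd.hdrop K hK
  -- leaf-06's eight binders at the pinned LATTICE cost, this cutoff (IR-51-1 part 2 §3)
  have vd : VolumeDisplaysS82 C d K (Dd.ℛ.R K) (fun t => Real.log (Dd.Φf.Λ K t)) ((1 + β₀) * F.L ^ d)
      (jvol82 d ((1 + β₀) * F.L ^ d)) :=
    volumeDisplaysS82L_of_log_eq_of_inInterval (D.C ⟨K, F.m, g₀ K⟩).flow (hIvL K) (Dd.hΛL K) Dd.hexpFL Dd.hdq Dd.hexpVL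
      Dd.hκ₂ Dd.hκᵥ Dd.hcΛ Dd.hMΛ hL1 Dd.hE₂ Dd.hE₃pos Dd.hθv Dd.hA₀.ne' Dd.hβ₀ Dd.hp27 (Dd.h27 K hK) (Dd.h29 K hK)
      (fun t ht => Dd.isRj K t ht) le_rfl
  simp only [HistReading.run_inputOf]
  exact plug_of_shrunk82 (I := Dd.ℛ.runOf K a (h, l, c)) (C := C) (Dd.hN K hK _ hτ) (Dd.hRm K hK _ hτ) (Dd.hRmS K hK _ hτ)
    (Dd.hRm2 K hK _ hτ) (Dd.hD K hK _ hτ) hL0 hL4 hdrop (Dd.one_le_R K hK) Dd.hn₁ Dd.hE₂.le Dd.hE₃pos.le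
    (fun j => Dd.Φf.one_le_Λ K j) vd.hΓ0 vd.hΓ vd.hj1 vd.hsmall vd.huS vd.huE₂ vd.huE₃

omit [RegularGaugeGroup G] in
/-- **THE IR-101-3 EMBEDDING AT THE ROUNDED LETTER**: a rounded lattice-unit prefix record `HistReadDataLWR` together with the
rounding window `InInterval e^{−ℓ⋆∕2} K` at `ℓ⋆ := ellStar C O F.L (O.d + 5) η η′ κ 1 Φ` and the LATTICE volume window
`InInterval e^{−ℓᵥ82ᴸ∕2} K` for every cutoff IS a plug record `HistReadDataLP` at the weight
`cvol82 d (jvol82 d ((1+β₀)·L^d)) ((1+β₀)·L^d)` — `sR`∕`sR′ := fun K => sRsharp (O.d + 5) 1 p₁ (ℛ.R K) g^K` (print's `r_h`),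
`hRR`∕`hRR′` by `roundingRoomF_sharp_of_couplings` at `(t, Ap₁) := (O.d + 5, 1)` moved to the record's birth letters by
`roundingRoomF_mono (hsB K)` ∕ `(hsB′ K)` (the OWNER's 2R junction,
p347728), `hwV` by `two_pow_le_cvol82`, `hplug := plug82LR_of_histReadingLWR`, `huV` by leaf-06's
`huθS82L_births_of_log_eq_of_inInterval` on the members' performed births, everything else copied from LWLP82's `toLP82L`
(`hE₃ := hE₃pos.le`). [folklore] -/
def _root_.Summit.QuantumFields.BalabanUV.T4Continuum.HistoryRealiseCellsRunAssemblyWTVSDataLWR.HistReadDataLWR.toLP82LR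
    (Dd : HistReadDataLWR D C O θv rr d n hn g₀ os cΛ M Φ β₀ p₁ η η' κ κ₂ κᵥ I I' Xs μ 𝒢 Y νB 𝒢')
    (hIr : ∀ K, (D.C ⟨K, F.m, g₀ K⟩).flow.InInterval
      (Real.exp (-(ellStar C O F.L (O.d + 5) η η' κ 1 Φ / 2))) K)
    (hIvL : ∀ K, (D.C ⟨K, F.m, g₀ K⟩).flow.InInterval
      (Real.exp (-(ellVolS82L C d κ₂ κᵥ cΛ M F.L θv ((1 + β₀) * F.L ^ d) (jvol82 d ((1 + β₀) * F.L ^ d)) / 2))) K) :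
    HistReadDataLP D C O θv rr d n hn g₀ os I I' Xs μ 𝒢 Y νB 𝒢' :=
  have hL1 : 1 ≤ F.L := le_trans (by norm_num) (two_le_L F)
  have hΓ0 : (0 : ℝ) ≤ (1 + β₀) * F.L ^ d := by have := Dd.hβ₀; positivity
  { l₀ := Dd.l₀, vol := Dd.vol, l₀_pos := Dd.l₀_pos, vol_pos := Dd.vol_pos, K₀ := Dd.K₀, RA := Dd.RA, ρA := Dd.ρA,
    holdsA := Dd.holdsA, intA := Dd.intA, H2A := Dd.H2A, ℛ := Dd.ℛ, hL := Dd.hL, hs := Dd.hs, Φf := Dd.Φf,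
    hR := Dd.hR, isRj := Dd.isRj, one_le_R := Dd.one_le_R, hL4 := Dd.hL4, hprof := Dd.hprof, hdrop := Dd.hdrop,
    hN := Dd.hN, hRm := Dd.hRm, hRmS := Dd.hRmS, hRm2 := Dd.hRm2, hD := Dd.hD, hreg := Dd.hreg, hn₁ := Dd.hn₁,
    hE₂ := Dd.hE₂, hE₃ := Dd.hE₃pos.le,
    -- IR-52-1: M5-2e's weight at the LATTICE growth, its floor, THE PLUG and the slack at that weight
    wV := fun _ => cvol82 d (jvol82 d ((1 + β₀) * F.L ^ d)) ((1 + β₀) * F.L ^ d),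
    hwV := fun _ _ => two_pow_le_cvol82 d _ hΓ0,
    hplug := plug82LR_of_histReadingLWR Dd hIvL,
    sB := Dd.sB,
    -- IR-101-3: print's ROUNDED renewal letter and the OWNER's 2R rounding junction at `(t, Ap₁) := (d+5, 1)`
    sR := fun K => sRsharp (O.d + 5) 1 p₁ (Dd.ℛ.R K) (D.C ⟨K, F.m, g₀ K⟩).flow.g,
    φB := Dd.φB, φR := Dd.φR, β' := Dd.β', β₀ := β₀, hF := Dd.hF,
    hRR := fun K hK =>
      roundingRoomF_mono (Dd.hsB K) (fun _ => le_rfl)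
        (roundingRoomF_sharp_of_couplings (t := O.d + 5) (Ap₁ := 1) Dd.hexpR Dd.hexpR' Dd.hexpB Dd.hη Dd.hη' Dd.hκ Dd.hp₀
          one_ne_zero Dd.hγ₀ Dd.hA₁ Dd.hA₀ Dd.hΦ Dd.hE₂ Dd.hE₃pos.le hL1 Dd.hm (Dd.h29 K hK) (fun j hj => Dd.isRj K j hj)
          le_rfl (hIr K) (Dd.hφB K) (Dd.hφR K)),
    h29 := Dd.h29,
    huV := fun K _ τ _ q hq => by
      obtain ⟨c, hc, rfl⟩ := mem_memOf.1 hq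
      obtain ⟨x, -, rfl⟩ := Finset.mem_image.1 hc
      exact huθS82L_births_of_log_eq_of_inInterval (D.C ⟨K, F.m, g₀ K⟩).flow (hIvL K) (Dd.hΛL K) Dd.hexpFL Dd.hdq
        Dd.hexpVL Dd.hκ₂ Dd.hκᵥ Dd.hcΛ Dd.hMΛ hL1 Dd.hE₂ Dd.hE₃pos Dd.hθv Dd.hA₀.ne' Dd.hβ₀ (fun t ht => Dd.isRj K t ht)
        le_rfl Prod.fst _ (births_le_of_step_le _ _ le_rfl),
    W := Dd.W, one_le_W := Dd.one_le_W, Wi := Dd.Wi, BAi := Dd.BAi, mi := Dd.mi, hWi := Dd.hWi, hBA := Dd.hBA,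
    hmi := Dd.hmi, hρ := Dd.hρ, c₀ := Dd.c₀, n₁ := Dd.n₁, c₀_pos := Dd.c₀_pos, floor := Dd.floor,
    floor' := Dd.floor', sites := Dd.sites, sites' := Dd.sites', RB := Dd.RB, ρB := Dd.ρB, holdsB := Dd.holdsB,
    intB := Dd.intB, H2B := Dd.H2B, trunc := Dd.trunc, htr := Dd.htr, dB := Dd.dB, mup := Dd.mup, sB' := Dd.sB',
    φB' := Dd.φB',
    sR' := fun K => sRsharp (O.d + 5) 1 p₁ (Dd.ℛ.R K) (D.C ⟨K, F.m, g₀ K⟩).flow.g,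
    φR' := Dd.φR',
    hRR' := fun K hK =>
      roundingRoomF_mono (Dd.hsB' K) (fun _ => le_rfl)
        (roundingRoomF_sharp_of_couplings (t := O.d + 5) (Ap₁ := 1) Dd.hexpR Dd.hexpR' Dd.hexpB Dd.hη Dd.hη' Dd.hκ Dd.hp₀
          one_ne_zero Dd.hγ₀ Dd.hA₁ Dd.hA₀ Dd.hΦ Dd.hE₂ Dd.hE₃pos.le hL1 Dd.hm (Dd.h29 K hK) (fun j hj => Dd.isRj K j hj)
          le_rfl (hIr K) (Dd.hφB' K) (Dd.hφR' K)),
    upB := Dd.upB, deadB_nonneg := Dd.deadB_nonneg, resumB := Dd.resumB, mup_bd := Dd.mup_bd, shA := Dd.shA,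
    shB := Dd.shB, Wsh := Dd.Wsh, shell := Dd.shell, Cc := Dd.Cc, Rr := Dd.Rr, CcRec := Dd.CcRec, RrRec := Dd.RrRec,
    ν := Dd.ν, u := Dd.u, s₂ := Dd.s₂, q₀ := Dd.q₀, r := Dd.r, s := Dd.s, budget := Dd.budget, sum_r := Dd.sum_r,
    sum_u := Dd.sum_u, sum_s := Dd.sum_s, sum_s₂ := Dd.sum_s₂ }

omit [RegularGaugeGroup G] in
/-- the embedding keeps the reading, the threshold, the factor data, the source radius and the truncation, FIXES the weight to
M5-2e's `cvol82` read at the LATTICE growth `(1+β₀)·L^d` and its lag `jvol82 d ((1+β₀)·L^d)`, and FIXES both renewal letters to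
print's rounded `r_h` [folklore] -/
theorem _root_.Summit.QuantumFields.BalabanUV.T4Continuum.HistoryRealiseCellsRunAssemblyWTVSDataLWR.HistReadDataLWR.toLP82LR_data
    (Dd : HistReadDataLWR D C O θv rr d n hn g₀ os cΛ M Φ β₀ p₁ η η' κ κ₂ κᵥ I I' Xs μ 𝒢 Y νB 𝒢')
    (hIr : ∀ K, (D.C ⟨K, F.m, g₀ K⟩).flow.InInterval
      (Real.exp (-(ellStar C O F.L (O.d + 5) η η' κ 1 Φ / 2))) K)
    (hIvL : ∀ K, (D.C ⟨K, F.m, g₀ K⟩).flow.InInterval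
      (Real.exp (-(ellVolS82L C d κ₂ κᵥ cΛ M F.L θv ((1 + β₀) * F.L ^ d) (jvol82 d ((1 + β₀) * F.L ^ d)) / 2))) K) :
    (Dd.toLP82LR hIr hIvL).ℛ = Dd.ℛ ∧ (Dd.toLP82LR hIr hIvL).K₀ = Dd.K₀ ∧ (Dd.toLP82LR hIr hIvL).Φf = Dd.Φf ∧
      (Dd.toLP82LR hIr hIvL).l₀ = Dd.l₀ ∧ (Dd.toLP82LR hIr hIvL).trunc = Dd.trunc ∧
      ((Dd.toLP82LR hIr hIvL).wV = fun _ => cvol82 d (jvol82 d ((1 + β₀) * F.L ^ d)) ((1 + β₀) * F.L ^ d)) ∧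
      ((Dd.toLP82LR hIr hIvL).sR = fun K => sRsharp (O.d + 5) 1 p₁ (Dd.ℛ.R K) (D.C ⟨K, F.m, g₀ K⟩).flow.g) ∧
      ((Dd.toLP82LR hIr hIvL).sR' = fun K => sRsharp (O.d + 5) 1 p₁ (Dd.ℛ.R K) (D.C ⟨K, F.m, g₀ K⟩).flow.g) :=
  ⟨rfl, rfl, rfl, rfl, rfl, rfl, rfl, rfl⟩

end Embed

/-! ## §2 The L-witness on M5-2e's ledger from a ROUNDED lattice-unit prefix record, window-explicit at `ellVolS82L` -/

section Assembly

variable {F : T4Family} {G : Type*} [GaugeGroup G] [MeasurableSpace G] [HaarData G] [RegularGaugeGroup G]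
  {D : FiniteEpsData F G} {C : T4PrintedShapeBanking.Consts} {O : PrintedO1s} {θv : ℝ} {rr d n : ℕ} {hn : 0 < n}
  {g₀ : ℕ → ℝ} {os : List (ULoop F)} {cΛ M Φ β₀ : ℝ} {p₁ η η' κ κ₂ κᵥ : ℕ} {DomK : ℕ → Type}
  {I : (K : ℕ) → HIndex (DomK K)} [DecidableEq (HIndex.Idx I)] {DomK' : ℕ → Type} {I' : (K : ℕ) → HIndex (DomK' K)}
  {Xs : ℕ → Type} [∀ K, MeasurableSpace (Xs K)] {μ : (K : ℕ) → Measure (Xs K)} [∀ K, IsFiniteMeasure (μ K)]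
  {𝒢 : (K : ℕ) → GoodClass (Xs K)} {Y : ℕ → Type} [∀ K, MeasurableSpace (Y K)] {νB : (K : ℕ) → Measure (Y K)}
  [∀ K, IsFiniteMeasure (νB K)] {𝒢' : (K : ℕ) → GoodClass (Y K)}

omit [RegularGaugeGroup G] in
/-- **THE L-WITNESS FROM A ROUNDED LATTICE-UNIT PREFIX RECORD ON M5-2e's LEDGER** (W4 §1 ∘ `toLP82LR`): the window-explicit
statement at the rounding threshold `e^{−ℓ⋆∕2}` (`ℓ⋆` at print's `t = d+5`, `Ap₁ = 1`) and the LATTICE volume threshold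
`e^{−ℓᵥ82ᴸ∕2}`. [folklore] -/
theorem nonempty_countRoadWitnessT3bWTVSL_of_histReadingLWR82
    (Dd : HistReadDataLWR D C O θv rr d n hn g₀ os cΛ M Φ β₀ p₁ η η' κ κ₂ κᵥ I I' Xs μ 𝒢 Y νB 𝒢')
    (hIr : ∀ K, (D.C ⟨K, F.m, g₀ K⟩).flow.InInterval
      (Real.exp (-(ellStar C O F.L (O.d + 5) η η' κ 1 Φ / 2))) K)
    (hIvL : ∀ K, (D.C ⟨K, F.m, g₀ K⟩).flow.InInterval
      (Real.exp (-(ellVolS82L C d κ₂ κᵥ cΛ M F.L θv ((1 + β₀) * F.L ^ d) (jvol82 d ((1 + β₀) * F.L ^ d)) / 2))) K) :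
    Nonempty (CountRoadWitnessT3bWTVSL D C O θv rr d n hn g₀ os (HIndex.Idx I) (ℕ × Lab d) (Lab d)) :=
  nonempty_countRoadWitnessT3bWTVSL_of_histReadingLP (Dd.toLP82LR hIr hIvL)

end Assembly

/-! ## §3 The terminal theorem: the headline from SOME rounded lattice-unit prefix record, for all small couplings -/

section SU

variable {F : T4Family} {N : ℕ} [NeZero N] {ℰ : LoopAverage (Matrix.specialUnitaryGroup (Fin N) ℂ)}

/-- **THE HEADLINE PREDICATE FROM A READING OF (1.72) UNDER THE HEADLINE's OWN PREFIX, VOLUME LETTER IN LATTICE UNITS, AT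
PRINT's ROUNDED RENEWAL LETTER** (IR-101-3 (b)): `T4ContinuumYM4Torus.ContinuumYM4Torus D` for (0.4)-block-averaged data on `SU(N)`
with a measurable small-loop average, GIVEN `(B)` and `BetaPertHyp` BY NAME, the sign conventions, the `_fsc` family's constants-only
side conditions, TEN window-threshold letters `cΛ M Φ b₀ p₁ η η′ κ κ₂ κᵥ` (bound HERE, outside the prefix; no `Lr`), and — for all
small-coupling tuned runs and every loop string — SOME rounded lattice-unit prefix record `HistReadDataLWR …` (skeletons, spaces,
measures existentially).  Proof: W4's `continuumYM4Torus_of_histReadingLP_fsc` ∘ the owner's two-window junction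
`forSmallCouplings_mono_inInterval₂` at the closed thresholds `e^{−ℓ⋆∕2}` (`ℓ⋆ := ellStar C O F.L (O.d+5) η η′ κ 1 Φ`, rounding at
print's `t = d+5`) and `e^{−ℓᵥ82ᴸ∕2}` (LATTICE volume) ∘ §1 `toLP82LR` — the non-tower twin of the OWNER's
`B16HistoryTowerEndLWRP82.continuumYM4Torus_of_towerReadingLWR_fsc` (p347728).  A NEW statement only because the record TYPE is new.
CONDITIONAL on everything the record displays; NE7b NOT proved; count 0∕9. [folklore] -/
theorem continuumYM4Torus_of_histReadingLWR_fsc (D : FiniteEpsData F (Matrix.specialUnitaryGroup (Fin N) ℂ))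
    (hBA : D.IsBlockAveraged ℰ) (hE : ℰ.MeasurableE)
    (hB : B16.EndStatementBPrinted D.C) (hβ : BetaPertHyp D.βfun) (hsign : B16.SignConventions D.C)
    {C : T4PrintedShapeBanking.Consts} {O : PrintedO1s}
    {rr : ℕ} {β₀ : ℝ} (h : ThresholdOK C F.L rr β₀) (hμ : 0 < C.μ) (d n : ℕ)
    (hκ₁ : (d : ℝ) * Real.log F.L + 2 * Real.log 2 ≤ C.κ₁) (hE₀ : Real.log (2 + birthMass C) ≤ C.E₀)
    (hA₀ : 1 ≤ C.A₀) (hβ₀ : 0 < β₀) (hLβ : (F.L : ℝ) * β₀ ≤ 1) (hn₁ : 13 ≤ C.n₁) (hn : 0 < n)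
    {θ θv : ℝ} (hθ : 0 < θ) (hslack : C.a + (θ + θv) ≤ O.γ₀ * O.A₁ ^ 2 / 2)
    (hE₂ : 0 < C.E₂) (hE₃ : 0 ≤ C.E₃) {sS : ℕ} (hsS : 1 ≤ sS)
    (hsmall : (((2 * cth 32 1 sS + 1) ^ d : ℕ) : ℝ) * (5 : ℝ) ^ d * ((max 1 (2 * 32 + 2) : ℕ) : ℝ) ≤
      (F.L : ℝ) ^ (sS / 2) / 2)
    {θc : ℝ} (hθc0 : 0 ≤ θc) (hθc1 : θc < 1) (hθcs : 1 / 2 ≤ θc ^ sS)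
    {cΛ M Φ b₀ : ℝ} {p₁ η η' κ κ₂ κᵥ : ℕ}
    (hRead : T4ContinuumYM4Torus.ForSmallCouplings D fun g₀ => ∀ os : List (ULoop F),
        ∃ (DomK : ℕ → Type) (I : (K : ℕ) → HIndex (DomK K)) (_ : DecidableEq (HIndex.Idx I)) (DomK' : ℕ → Type)
          (I' : (K : ℕ) → HIndex (DomK' K)) (X : ℕ → Type) (_ : ∀ K, MeasurableSpace (X K))
          (μ : (K : ℕ) → Measure (X K)) (_ : ∀ K, IsFiniteMeasure (μ K)) (𝒢 : (K : ℕ) → GoodClass (X K))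
          (Y : ℕ → Type) (_ : ∀ K, MeasurableSpace (Y K)) (νB : (K : ℕ) → Measure (Y K))
          (_ : ∀ K, IsFiniteMeasure (νB K)) (𝒢' : (K : ℕ) → GoodClass (Y K)),
          Nonempty (HistReadDataLWR D C O θv rr d n hn g₀ os cΛ M Φ b₀ p₁ η η' κ κ₂ κᵥ I I' X μ 𝒢 Y νB 𝒢')) :
    T4ContinuumYM4Torus.ContinuumYM4Torus D :=
  continuumYM4Torus_of_histReadingLP_fsc D hBA hE hB hβ hsign h hμ d n hκ₁ hE₀ hA₀ hβ₀ hLβ hn₁ hn hθ hslack hE₂ hE₃ hsS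
    hsmall hθc0 hθc1 hθcs
    (forSmallCouplings_mono_inInterval₂ D
      (Real.exp_pos (-(ellStar C O F.L (O.d + 5) η η' κ 1 Φ / 2)))
      (Real.exp_pos (-(ellVolS82L C d κ₂ κᵥ cΛ M F.L θv ((1 + b₀) * F.L ^ d) (jvol82 d ((1 + b₀) * F.L ^ d)) / 2)))
      (fun g₀ hIr hIv hg os => by
        obtain ⟨DomK, I, iI, DomK', I', X, mX, μ, hμf, 𝒢, Y, mY, νB, hνf, 𝒢', ⟨Dd⟩⟩ := hg os
        exact ⟨DomK, I, iI, DomK', I', X, mX, μ, hμf, 𝒢, Y, mY, νB, hνf, 𝒢', ⟨Dd.toLP82LR hIr hIv⟩⟩)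
      hRead)

end SU

end

end Summit.QuantumFields.BalabanUV.T4Continuum.HistoryRealiseCellsRunAssemblyWTVSLWRP82R
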